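import Literature.MathematicalPhysics.QuantumFieldTheory.Balaban1983to89.B5LaplaceSpectral
import Summits.QuantumFields.BalabanUV.T4Continuum.Support.InverseComparison
import Summits.QuantumFields.BalabanUV.T4Continuum.Support.OneStepEffectiveOperator
import Summits.QuantumFields.BalabanUV.T4Continuum.Support.ScalarMassTower
import Summits.QuantumFields.BalabanUV.T4Continuum.Support.ScalarPlantingDefect
import Summits.QuantumFields.BalabanUV.T4Continuum.Spine.BackgroundResolventTower

/-!
# T⁴ programme, spine node NE2 (U1a), tier B support row B4.d — THE SCALAR SANDWICH LAW REDUCED TO THE EFFECTIVE-LAPLACIAN EXCESS: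
# `J₀ᴴG′_{RN}J₀ = (Δ̃ + a′Π′)⁻¹` EXACTLY, `Δ ≤ Δ̃`, `0 ≤ G′_N − J₀ᴴG′_{RN}J₀ ≤ G′_N(Δ̃ − Δ)G′_N`, and the injected defect
# `‖G′_{RN}J₀ − J₀G′_N‖ ≤ e₀ + ‖G′_N(Δ̃ − Δ)G′_N‖` (file 5b of row B4.d)

NE2 formalisation swarm `b2b-balaban-t4-ne2-formalise-*`, seat LEAF PROVER 04, support row B4.d of `t4/formal/NE2/LEAVES.md` («U = 1 scalar
free-tower laws against King's pairing» — the planting/complement/injected defects of the scalar layer consumed as DATA by row B4.b).  Files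
1–4 of the row gave the abstract effective operator (`OneStepEffectiveOperator.sandwich_inv_eq`), King's 0-form planting `J₀ = JK0 N R M`
with its one-step Poincaré inequality, the exact intertwining `Δ′_{RN} = Δ_{RN} + J₀(a′Π′_N)J₀ᴴ` (`ScalarPlantingDefect.DeltaPs_eq_sandwich`)
and the complement defect.  This file performs the REDUCTION of the remaining law — the injected defect — to ONE inequality about the
one-step EFFECTIVE LAPLACIAN `Δ̃ := effOp (LapS_{RN}) J₀` of the free scalar field:

 * §1 generic tools: `opNorm_le_of_form_le` (a Hermitian positive semidefinite matrix whose form is `≤ C‖v‖²` has norm `≤ C`) and the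
   **LEGENDRE COMPARISON** `re_form_inv_sub_inv_le` / `_nonneg`: for Hermitian `A ≤ A′` with `A, A′` invertible and `A, A′ ≥ 0`,
   `0 ≤ ⟨v, (A⁻¹ − A′⁻¹)v⟩ ≤ ⟨A⁻¹v, (A′ − A)A⁻¹v⟩` (complete the square), hence `‖A⁻¹ − A′⁻¹‖ ≤ sup ⟨A⁻¹v,(A′ − A)A⁻¹v⟩/‖v‖²`;
 * §2 the scalar instance: `admissible_LapS_JK0` (`LapS′ + J₀J₀ᴴ > 0`), **`sandwich_Gps_eq : J₀ᴴ G′_{RN} J₀ = (effLap + a′Π′_N)⁻¹`**,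
   **`LapS_le_effLap`** (`Δ_N ≤ Δ̃`: the coarse Dirichlet energy of block averages is at most the fine one — `∂_νJ₀ᴴ = M_ν∂′_ν` with
   `‖M_ν‖ ≤ 1` by `Q₀ S′^R = S Q₀` and a geometric sum), hence **`opNorm_Gps_sub_sandwich_le`**:
   `‖G′_N − J₀ᴴG′_{RN}J₀‖ ≤ C` whenever `⟨G′_Nv, (Δ̃ − Δ_N) G′_Nv⟩ ≤ C‖v‖²` for all `v`;
 * §3 **`opNorm_injected_le`**: `‖G′_{RN}J₀ − J₀G′_N‖ ≤ 2d√(γ′⁻¹)/N + C` under the same excess hypothesis — so the scalar tower's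
   `FreeTowerLaws.injected_le` holds with `e₁ k = (2d√(γ′⁻¹) + C_X)·L^{−k}` as soon as the EFFECTIVE-LAPLACIAN EXCESS on the range of
   `G′` is `≤ C_X/N` (file 6 of the row proves it from a spectral test extension; nothing is asserted here).

HONEST FRAMING (T4-DAG p. 1).  `U = 1`, finite torus, scalar (0-form) layer, operator norm; finite-dimensional linear algebra + one
telescoping identity; statements / constants OURS ([folklore]); a SUPPORT input of row B4.b, NOT B4, NOT [Balaban1985BackgroundPropagators]
(3.23)–(3.26) as printed; NE2 NOT proved; NOT infinite volume / mass gap / Clay / summit progress; spine 0/9 unchanged.  HONEST DEPENDENCY: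
continuum YM on T⁴ ⇐ BetaPertH ∧ nine spine estimates (0/9 proved); BetaPertH ⇐ (D1) ∧ (D4) ∧ CAP+tail; G-an2-4 gates asym, D1 and NE2/3/4.
ABSOLUTE RULE kept; no `sorry`.
-/

noncomputable section

open scoped BigOperators ComplexConjugate ComplexOrder Matrix Matrix.Norms.L2Operator

namespace Summit.QuantumFields.BalabanUV.T4Continuum.ScalarSandwichReduction

open Literature.MathematicalPhysics.QuantumFieldTheory.Balaban1983to89.B5Prop11Plancherel
open Literature.MathematicalPhysics.QuantumFieldTheory.Balaban1983to89.B5Prop11Lower (nsq nsq_nonneg star_dotProduct_self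
  norm_star_dotProduct_le)
open Literature.MathematicalPhysics.QuantumFieldTheory.Balaban1983to89.B5Action121 (shiftS sdiff LapS shiftS_mulVec)
open Literature.MathematicalPhysics.QuantumFieldTheory.Balaban1983to89.B5LaplaceSpectral (LapS_isHermitian form_LapS const_of_sdiff_eq_zero)
open Literature.MathematicalPhysics.QuantumFieldTheory.Balaban1983to89.B5Block118 (tstep tstep_zero tstep_succ)
open Literature.MathematicalPhysics.QuantumFieldTheory.Balaban1983to89.B5G183RateOp (opNorm_le_of_schur)
open Literature.MathematicalPhysics.QuantumFieldTheory.Balaban1983to89.B5G183RateTorus (cpt)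
open Literature.MathematicalPhysics.QuantumFieldTheory.Balaban1983to89.B5G183RateTorusW (off)
open Literature.MathematicalPhysics.QuantumFieldTheory.Balaban1983to89.B5G183RateUnitTower (lev lev_neZero)
open Summit.QuantumFields.BalabanUV.T4Continuum.BalabanAveragedTowerUnit (cast_lev')
open Summit.QuantumFields.BalabanUV.T4Continuum.BackgroundResolventTower (FreeTowerLaws)
open Summit.QuantumFields.BalabanUV.T4Continuum
open Summit.QuantumFields.BalabanUV.T4Continuum.BalabanAveragedTowerModes (par)
open Summit.QuantumFields.BalabanUV.T4Continuum.BalabanBlockPoincare (nsq_mulVec_le_rect)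
open Summit.QuantumFields.BalabanUV.T4Continuum.OneStepEffectiveOperator
open Summit.QuantumFields.BalabanUV.T4Continuum.ScalarMassTower (cpt_add_unitVec)
open Summit.QuantumFields.BalabanUV.T4Continuum.ScalarBlockPoincare (PiS nsq_PiS_mulVec_le)
open Summit.QuantumFields.BalabanUV.T4Continuum.ScalarAveragedPropagator (DeltaPs gammaPs Gps gammaPs_pos Gps_isHermitian
  DeltaPs_isHermitian DeltaPs_posDef isUnit_det_DeltaPs re_form_DeltaPs dirichlet dirichlet_nonneg opNorm_le_of_nsq_le_rect
  opNorm_Gps_le opNorm_sdiff_mul_Gps_le)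
open Summit.QuantumFields.BalabanUV.T4Continuum.ScalarBlockPlanting
open Summit.QuantumFields.BalabanUV.T4Continuum.ScalarPlantingDefect
open Summit.QuantumFields.BalabanUV.T4Continuum.InverseComparison

variable {d : ℕ}

/-! ## §2 The scalar instance: admissibility, the exact sandwich, `Δ ≤ Δ̃`, the sandwich law from the excess -/

section TwoLevel

variable (N R : ℕ) [NeZero N] [NeZero R] (M : Fin d → ℕ) [hM : ∀ μ, NeZero (M μ)]

/-- rows of `S_ν X` on 0-forms: `(S_νX)(x) = X(x + e_ν)`. [folklore] -/
theorem shiftS_mul_apply {Nf : Fin d → ℕ} [∀ μ, NeZero (Nf μ)] {β : Type*} (ν : Fin d) (X : Matrix (Tor Nf) β ℂ) (x : Tor Nf) (b : β) :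
    (shiftS Nf ν * X) x b = X (x + unitVec Nf ν) b := by
  simp only [Matrix.mul_apply, shiftS, ite_mul, one_mul, zero_mul]
  rw [Finset.sum_ite_eq' Finset.univ (x + unitVec Nf ν)]
  simp

/-- rows of `S_ν^t X`: `(S_ν^tX)(x) = X(x + t·e_ν)`. [folklore] -/
theorem shiftS_pow_mul_apply {Nf : Fin d → ℕ} [∀ μ, NeZero (Nf μ)] {β : Type*} (ν : Fin d) (X : Matrix (Tor Nf) β ℂ) :
    ∀ (t : ℕ) (x : Tor Nf) (b : β), (shiftS Nf ν ^ t * X) x b = X (x + tstep Nf ν t) b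
  | 0, x, b => by rw [pow_zero, Matrix.one_mul, tstep_zero, add_zero]
  | t + 1, x, b => by
    rw [pow_succ, Matrix.mul_assoc, shiftS_pow_mul_apply ν (shiftS Nf ν * X) t x b, shiftS_mul_apply, tstep_succ, add_assoc]

/-- `‖S_ν‖ ≤ 1` on 0-forms (a permutation matrix). [folklore] -/
theorem opNorm_shiftS_le {Nf : Fin d → ℕ} [∀ μ, NeZero (Nf μ)] (ν : Fin d) : ‖shiftS Nf ν‖ ≤ 1 := by
  refine opNorm_le_of_schur _ zero_le_one (fun x => ?_) (fun y => ?_)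
  · simp only [shiftS]
    rw [Finset.sum_eq_single (x + unitVec Nf ν)]
    · simp
    · intro y _ hy; rw [if_neg hy, norm_zero]
    · intro h; exact absurd (Finset.mem_univ _) h
  · simp only [shiftS]
    have e : ∀ x : Tor Nf, (y = x + unitVec Nf ν) ↔ (x = y - unitVec Nf ν) := fun x =>
      ⟨fun h => by rw [h, add_sub_cancel_right], fun h => by rw [h, sub_add_cancel]⟩
    simp_rw [e]
    rw [Finset.sum_eq_single (y - unitVec Nf ν)]
    · simp
    · intro x _ hx; rw [if_neg hx, norm_zero]
    · intro h; exact absurd (Finset.mem_univ _) h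

/-- `‖S_ν^t‖ ≤ 1`. [folklore] -/
theorem opNorm_shiftS_pow_le {Nf : Fin d → ℕ} [∀ μ, NeZero (Nf μ)] (ν : Fin d) : ∀ t : ℕ, ‖shiftS Nf ν ^ t‖ ≤ 1
  | 0 => by rw [pow_zero]; exact CovariantAveragingTower.opNorm_one_le (ι := fun _ => Tor Nf) 0
  | t + 1 => by
    rw [pow_succ]
    calc ‖shiftS Nf ν ^ t * shiftS Nf ν‖ ≤ ‖shiftS Nf ν ^ t‖ * ‖shiftS Nf ν‖ := Matrix.l2_opNorm_mul _ _
      _ ≤ 1 * 1 := mul_le_mul (opNorm_shiftS_pow_le ν t) (opNorm_shiftS_le ν) (norm_nonneg _) zero_le_one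
      _ = 1 := one_mul 1

/-- **`Q₀ S′_ν^R = S_ν Q₀`**: averaging a 0-form translated by one block = translating the averages by one site. [folklore] -/
theorem Qavg0_mul_shiftS_pow (ν : Fin d) :
    Qavg0 N R M * shiftS (fine (R * N) M) ν ^ R = shiftS (fine N M) ν * Qavg0 N R M := by
  have key : ∀ X : Matrix (Tor (fine (R * N) M)) (Tor (fine (R * N) M)) ℂ,
      Qavg0 N R M * (shiftS (fine (R * N) M) ν ^ R * X) = shiftS (fine N M) ν * (Qavg0 N R M * X) := by
    intro X
    ext y b
    rw [Qavg0_mul_apply, shiftS_mul_apply, Qavg0_mul_apply]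
    congr 1
    refine Finset.sum_congr rfl fun j _ => ?_
    rw [shiftS_pow_mul_apply, cpt_add_unitVec, add_right_comm (cpt N R M y)]
  have h := key 1
  rwa [Matrix.mul_one, Matrix.mul_one] at h

/-- the averaging operator `M_ν = (N/(RN))·√(R^d)·Q₀·Σ_{t<R} S′_ν^t` (fine 0-forms → coarse 0-forms). [folklore] -/
def avgShift (ν : Fin d) : Matrix (Tor (fine N M)) (Tor (fine (R * N) M)) ℂ :=
  (((N : ℂ) * (((R * N : ℕ) : ℂ))⁻¹ * (((Real.sqrt ((R : ℝ) ^ d)) : ℝ) : ℂ))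
    • (Qavg0 N R M * ∑ t ∈ Finset.range R, shiftS (fine (R * N) M) ν ^ t))

/-- **`∂_ν J₀ᴴ = M_ν ∂′_ν`**: the coarse difference of the block averages is an average of fine differences. [folklore] -/
theorem sdiff_mul_JK0H (ν : Fin d) :
    sdiff (fine N M) (N : ℂ) ν * (JK0 N R M)ᴴ = avgShift N R M ν * sdiff (fine (R * N) M) ((R * N : ℕ) : ℂ) ν := by
  have hRN : ((R * N : ℕ) : ℂ) ≠ 0 := by exact_mod_cast (Nat.mul_ne_zero (NeZero.ne R) (NeZero.ne N))
  obtain ⟨hs, -⟩ := KingPairingPlantedLaw.sqrt_facts (d := d) R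
  have e1 : sdiff (fine (R * N) M) ((R * N : ℕ) : ℂ) ν = (((R * N : ℕ) : ℂ)) • (shiftS (fine (R * N) M) ν - 1) := rfl
  have e2 : sdiff (fine N M) (N : ℂ) ν = (N : ℂ) • (shiftS (fine N M) ν - 1) := rfl
  -- `(S − 1)Q₀ = Q₀(S′^R − 1) = Q₀ (Σ S′^t)(S′ − 1)`
  have e3 : (shiftS (fine N M) ν - 1) * Qavg0 N R M
      = Qavg0 N R M * (∑ t ∈ Finset.range R, shiftS (fine (R * N) M) ν ^ t) * (shiftS (fine (R * N) M) ν - 1) := by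
    rw [Matrix.mul_assoc, geom_sum_mul, Matrix.mul_sub, Matrix.mul_one, Matrix.sub_mul, Matrix.one_mul, Qavg0_mul_shiftS_pow]
  calc sdiff (fine N M) (N : ℂ) ν * (JK0 N R M)ᴴ
      = ((N : ℂ) * (((Real.sqrt ((R : ℝ) ^ d)) : ℝ) : ℂ)) • ((shiftS (fine N M) ν - 1) * Qavg0 N R M) := by
        rw [JK0, Matrix.conjTranspose_smul, Matrix.conjTranspose_conjTranspose, hs, e2, Matrix.smul_mul, Matrix.mul_smul, smul_smul]
    _ = ((N : ℂ) * (((Real.sqrt ((R : ℝ) ^ d)) : ℝ) : ℂ))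
          • (Qavg0 N R M * (∑ t ∈ Finset.range R, shiftS (fine (R * N) M) ν ^ t) * (shiftS (fine (R * N) M) ν - 1)) := by rw [e3]
    _ = avgShift N R M ν * sdiff (fine (R * N) M) ((R * N : ℕ) : ℂ) ν := by
        rw [avgShift, e1, Matrix.mul_smul, Matrix.smul_mul, smul_smul]
        congr 1
        field_simp

/-- `‖M_ν‖ ≤ 1`. [folklore] -/
theorem opNorm_avgShift_le (ν : Fin d) : ‖avgShift N R M ν‖ ≤ 1 := by
  have hR : (0 : ℝ) < R := by exact_mod_cast Nat.pos_of_ne_zero (NeZero.ne R)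
  have hN : (0 : ℝ) < N := by exact_mod_cast Nat.pos_of_ne_zero (NeZero.ne N)
  have hRd : (0 : ℝ) < (R : ℝ) ^ d := pow_pos hR d
  have hs0 : 0 < Real.sqrt ((R : ℝ) ^ d) := Real.sqrt_pos.mpr hRd
  -- the scalar is `R⁻¹·√(R^d)`
  have hc : ‖((N : ℂ) * (((R * N : ℕ) : ℂ))⁻¹ * (((Real.sqrt ((R : ℝ) ^ d)) : ℝ) : ℂ))‖ = (R : ℝ)⁻¹ * Real.sqrt ((R : ℝ) ^ d) := by
    rw [norm_mul, norm_mul, norm_inv, Complex.norm_natCast, Complex.norm_natCast, Complex.norm_real, Real.norm_of_nonneg hs0.le]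
    push_cast
    field_simp
  -- `‖Q₀‖ ≤ R^{−d/2}`, `‖Σ S^t‖ ≤ R`
  have hQ : ‖Qavg0 N R M‖ ≤ (Real.sqrt ((R : ℝ) ^ d))⁻¹ := by
    have h := opNorm_Qavg0_sq_le N R M
    rw [← Real.sqrt_inv]
    exact Real.le_sqrt_of_sq_le h
  have hS : ‖∑ t ∈ Finset.range R, shiftS (fine (R * N) M) ν ^ t‖ ≤ R := by
    calc ‖∑ t ∈ Finset.range R, shiftS (fine (R * N) M) ν ^ t‖ ≤ ∑ t ∈ Finset.range R, ‖shiftS (fine (R * N) M) ν ^ t‖ := norm_sum_le _ _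
      _ ≤ ∑ _t ∈ Finset.range R, (1 : ℝ) := Finset.sum_le_sum fun t _ => opNorm_shiftS_pow_le ν t
      _ = R := by simp
  rw [avgShift, norm_smul, hc]
  calc (R : ℝ)⁻¹ * Real.sqrt ((R : ℝ) ^ d) * ‖Qavg0 N R M * ∑ t ∈ Finset.range R, shiftS (fine (R * N) M) ν ^ t‖
      ≤ (R : ℝ)⁻¹ * Real.sqrt ((R : ℝ) ^ d) * ((Real.sqrt ((R : ℝ) ^ d))⁻¹ * R) := by
        refine mul_le_mul_of_nonneg_left ((Matrix.l2_opNorm_mul _ _).trans (mul_le_mul hQ hS (norm_nonneg _) (by positivity))) (by positivity)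
    _ = 1 := by field_simp

/-- `nsq v = 0 ⟹ v = 0`. [folklore] -/
theorem eq_zero_of_nsq_eq_zero {m : Type*} [Fintype m] {v : m → ℂ} (h : nsq v = 0) : v = 0 := by
  funext i
  have h1 := (Finset.sum_eq_zero_iff_of_nonneg (fun j _ => sq_nonneg ‖v j‖)).mp h i (Finset.mem_univ i)
  exact norm_eq_zero.mp (pow_eq_zero_iff two_ne_zero |>.mp h1)

omit [NeZero N] [NeZero R] hM in
/-- `⟨Jᴴφ, w⟩ = ⟨φ, J w⟩`. [folklore] -/
theorem star_JH_mulVec_dotProduct {α β : Type*} [Fintype α] [Fintype β] (J : Matrix α β ℂ) (φ : α → ℂ) (w : β → ℂ) :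
    star (Jᴴ *ᵥ φ) ⬝ᵥ w = star φ ⬝ᵥ (J *ᵥ w) := by
  rw [Matrix.star_mulVec, Matrix.conjTranspose_conjTranspose, ← Matrix.dotProduct_mulVec]

/-- **`Δ′_{RN} − J₀ Δ_N J₀ᴴ ≥ 0`**: the coarse Dirichlet energy of the block averages is at most the fine Dirichlet energy. [folklore] -/
theorem LapS_sub_conj_posSemidef :
    (LapS (fine (R * N) M) ((R * N : ℕ) : ℂ) - JK0 N R M * LapS (fine N M) (N : ℂ) * (JK0 N R M)ᴴ).PosSemidef := by
  have hH : (LapS (fine (R * N) M) ((R * N : ℕ) : ℂ) - JK0 N R M * LapS (fine N M) (N : ℂ) * (JK0 N R M)ᴴ).IsHermitian := by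
    refine (LapS_isHermitian _ _).sub ?_
    simpa only [Matrix.mul_assoc] using Matrix.isHermitian_mul_mul_conjTranspose (JK0 N R M) (LapS_isHermitian (fine N M) (N : ℂ))
  refine Matrix.PosSemidef.of_dotProduct_mulVec_nonneg hH fun φ => ?_
  -- the form is the real number `Σ_ν [nsq (∂′_νφ) − nsq (∂_ν Jᴴφ)]`
  have e1 : star φ ⬝ᵥ ((LapS (fine (R * N) M) ((R * N : ℕ) : ℂ) - JK0 N R M * LapS (fine N M) (N : ℂ) * (JK0 N R M)ᴴ) *ᵥ φ)
      = (((∑ ν, nsq (sdiff (fine (R * N) M) ((R * N : ℕ) : ℂ) ν *ᵥ φ)) : ℝ) : ℂ)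
        - (((∑ ν, nsq (sdiff (fine N M) (N : ℂ) ν *ᵥ ((JK0 N R M)ᴴ *ᵥ φ))) : ℝ) : ℂ) := by
    rw [Matrix.sub_mulVec, dotProduct_sub, ScalarBlockPoincare.form_LapS_eq, Matrix.mul_assoc, ← Matrix.mulVec_mulVec,
      ← Matrix.mulVec_mulVec, ← star_JH_mulVec_dotProduct (JK0 N R M), ScalarBlockPoincare.form_LapS_eq]
  rw [e1, ← Complex.ofReal_sub, Complex.zero_le_real, sub_nonneg]
  refine Finset.sum_le_sum fun ν _ => ?_
  -- `∂_ν Jᴴ φ = M_ν ∂′_ν φ`, `‖M_ν‖ ≤ 1`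
  rw [Matrix.mulVec_mulVec, sdiff_mul_JK0H, ← Matrix.mulVec_mulVec]
  calc nsq (avgShift N R M ν *ᵥ (sdiff (fine (R * N) M) ((R * N : ℕ) : ℂ) ν *ᵥ φ))
      ≤ ‖avgShift N R M ν‖ ^ 2 * nsq (sdiff (fine (R * N) M) ((R * N : ℕ) : ℂ) ν *ᵥ φ) := nsq_mulVec_le_rect _ _
    _ ≤ 1 ^ 2 * nsq (sdiff (fine (R * N) M) ((R * N : ℕ) : ℂ) ν *ᵥ φ) :=
        mul_le_mul_of_nonneg_right (pow_le_pow_left₀ (norm_nonneg _) (opNorm_avgShift_le N R M ν) 2) (nsq_nonneg _)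
    _ = _ := by rw [one_pow, one_mul]

variable (a' : ℝ)

/-- the ONE-STEP EFFECTIVE LAPLACIAN of the free scalar field between the two levels. [folklore] -/
abbrev effLap : Matrix (Tor (fine N M)) (Tor (fine N M)) ℂ := effOp (LapS (fine (R * N) M) ((R * N : ℕ) : ℂ)) (JK0 N R M)

/-- `Π′_{RN} ≤ Π₀` in the form sense: `nsq (Π′_{RN}x) ≤ nsq (J₀ᴴx)` (big-block means are means of sub-block means). [folklore] -/
theorem nsq_PiS_le_nsq_JK0H (x : Tor (fine (R * N) M) → ℂ) : nsq (PiS (R * N) M *ᵥ x) ≤ nsq ((JK0 N R M)ᴴ *ᵥ x) := by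
  rw [PiS_eq_sandwich, Matrix.mul_assoc, ← Matrix.mulVec_mulVec, ← Matrix.mulVec_mulVec]
  calc nsq (JK0 N R M *ᵥ (PiS N M *ᵥ ((JK0 N R M)ᴴ *ᵥ x))) ≤ ‖JK0 N R M‖ ^ 2 * nsq (PiS N M *ᵥ ((JK0 N R M)ᴴ *ᵥ x)) :=
        nsq_mulVec_le_rect _ _
    _ ≤ 1 ^ 2 * nsq ((JK0 N R M)ᴴ *ᵥ x) :=
        mul_le_mul (pow_le_pow_left₀ (norm_nonneg _) (opNorm_JK0_le N R M) 2) (nsq_PiS_mulVec_le _ M _) (nsq_nonneg _) (by positivity)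
    _ = nsq ((JK0 N R M)ᴴ *ᵥ x) := by rw [one_pow, one_mul]

/-- **ADMISSIBILITY**: `Δ′_{RN} + J₀J₀ᴴ` is positive definite (it dominates `Δ′_{RN} + Π′_{RN} = DeltaPs (RN) M 1 > 0`). [folklore] -/
theorem admissible_LapS_JK0 : Admissible (LapS (fine (R * N) M) ((R * N : ℕ) : ℂ)) (JK0 N R M) := by
  refine admissible_of_posDef (JK0_conjTranspose_mul_JK0 N R M) ?_
  have hH : (LapS (fine (R * N) M) ((R * N : ℕ) : ℂ) + JK0 N R M * (JK0 N R M)ᴴ).IsHermitian :=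
    (LapS_isHermitian _ _).add (Matrix.isHermitian_mul_conjTranspose_self _)
  refine Matrix.PosDef.of_dotProduct_mulVec_pos hH fun x hx => ?_
  have hform : star x ⬝ᵥ ((LapS (fine (R * N) M) ((R * N : ℕ) : ℂ) + JK0 N R M * (JK0 N R M)ᴴ) *ᵥ x)
      = (((∑ ν, nsq (sdiff (fine (R * N) M) ((R * N : ℕ) : ℂ) ν *ᵥ x)) + nsq ((JK0 N R M)ᴴ *ᵥ x) : ℝ) : ℂ) := by
    rw [Matrix.add_mulVec, dotProduct_add, ScalarBlockPoincare.form_LapS_eq, ← Matrix.mulVec_mulVec,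
      ← star_JH_mulVec_dotProduct (JK0 N R M), star_dotProduct_self, Complex.ofReal_add]
  have hpos := (DeltaPs_posDef (R * N) M one_pos).re_dotProduct_pos hx
  rw [RCLike.re_to_complex, re_form_DeltaPs, one_mul] at hpos
  rw [hform, Complex.zero_lt_real]
  have h1 := nsq_PiS_le_nsq_JK0H N R M x
  unfold dirichlet at hpos
  linarith

/-- **THE EXACT SANDWICH**: `J₀ᴴ G′_{RN} J₀ = (Δ̃ + a′Π′_N)⁻¹`. [folklore] -/
theorem sandwich_Gps_eq (ha' : 0 < a') :
    (JK0 N R M)ᴴ * Gps (R * N) M a' * JK0 N R M = (effLap N R M + (a' : ℂ) • PiS N M)⁻¹ := by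
  have hu : IsUnit (LapS (fine (R * N) M) ((R * N : ℕ) : ℂ) + JK0 N R M * ((a' : ℂ) • PiS N M) * (JK0 N R M)ᴴ) := by
    rw [← DeltaPs_eq_sandwich]
    exact (Matrix.isUnit_iff_isUnit_det _).mpr (isUnit_det_DeltaPs (R * N) M ha')
  rw [Gps, DeltaPs_eq_sandwich]
  exact sandwich_inv_eq (admissible_LapS_JK0 N R M) hu

/-- `Δ̃ + a′Π′_N` is invertible. [folklore] -/
theorem isUnit_det_effLap_add (ha' : 0 < a') : IsUnit (effLap N R M + (a' : ℂ) • PiS N M).det := by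
  have hu : IsUnit (LapS (fine (R * N) M) ((R * N : ℕ) : ℂ) + JK0 N R M * ((a' : ℂ) • PiS N M) * (JK0 N R M)ᴴ) := by
    rw [← DeltaPs_eq_sandwich]
    exact (Matrix.isUnit_iff_isUnit_det _).mpr (isUnit_det_DeltaPs (R * N) M ha')
  exact (Matrix.isUnit_iff_isUnit_det _).mp (isUnit_effOp_add (admissible_LapS_JK0 N R M) hu)

/-- **`Δ_N ≤ Δ̃`** (as a positive semidefinite difference). [folklore] -/
theorem effLap_sub_LapS_posSemidef : (effLap N R M - LapS (fine N M) (N : ℂ)).PosSemidef :=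
  le_effOp_of_conj_le (admissible_LapS_JK0 N R M) (LapS_sub_conj_posSemidef N R M)

/-- `Δ̃ + a′Π′_N` is Hermitian. [folklore] -/
theorem effLap_add_isHermitian : (effLap N R M + (a' : ℂ) • PiS N M).IsHermitian := by
  refine (effOp_isHermitian (LapS_isHermitian _ _)).add ?_
  unfold Matrix.IsHermitian
  rw [Matrix.conjTranspose_smul, (ScalarAveragedPropagator.PiS_isHermitian N M).eq, Complex.star_def, Complex.conj_ofReal]

/-- **THE SANDWICH LAW FROM THE EXCESS**: if `Re⟨G′_Nv, (Δ̃ − Δ_N)G′_Nv⟩ ≤ C·Σ|v|²` for all `v`, then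
`‖G′_N − J₀ᴴ G′_{RN} J₀‖ ≤ C`. [folklore] -/
theorem opNorm_Gps_sub_sandwich_le (ha' : 0 < a') {C : ℝ} (hC : 0 ≤ C)
    (hX : ∀ v, (star (Gps N M a' *ᵥ v) ⬝ᵥ ((effLap N R M - LapS (fine N M) (N : ℂ)) *ᵥ (Gps N M a' *ᵥ v))).re ≤ C * nsq v) :
    ‖Gps N M a' - (JK0 N R M)ᴴ * Gps (R * N) M a' * JK0 N R M‖ ≤ C := by
  rw [sandwich_Gps_eq N R M a' ha', Gps]
  have hdiff : effLap N R M + (a' : ℂ) • PiS N M - DeltaPs N M a' = effLap N R M - LapS (fine N M) (N : ℂ) := by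
    rw [DeltaPs]; abel
  refine opNorm_inv_sub_inv_le_of_excess (DeltaPs_isHermitian N M a') (effLap_add_isHermitian N R M a') (fun z => ?_) (fun z => ?_)
    (isUnit_det_DeltaPs N M ha') (isUnit_det_effLap_add N R M a' ha') hC (fun v => ?_)
  · rw [re_form_DeltaPs]
    have := dirichlet_nonneg N M z
    have := nsq_nonneg (PiS N M *ᵥ z)
    positivity
  · have h := (effLap_sub_LapS_posSemidef N R M).re_dotProduct_nonneg z
    rw [RCLike.re_to_complex, ← hdiff, Matrix.sub_mulVec, dotProduct_sub, Complex.sub_re] at h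
    linarith
  · rw [hdiff]; exact hX v

/-! ## §3 The injected defect from the complement defect and the excess -/

/-- **THE INJECTED DEFECT**: `‖G′_{RN}J₀ − J₀G′_N‖ ≤ 2d√(γ′⁻¹)/N + C` under the excess hypothesis. [folklore] -/
theorem opNorm_injected_le (hd : 0 < d) (ha' : 0 < a') {C : ℝ} (hC : 0 ≤ C)
    (hX : ∀ v, (star (Gps N M a' *ᵥ v) ⬝ᵥ ((effLap N R M - LapS (fine N M) (N : ℂ)) *ᵥ (Gps N M a' *ᵥ v))).re ≤ C * nsq v) :
    ‖Gps (R * N) M a' * JK0 N R M - JK0 N R M * Gps N M a'‖ ≤ 2 * d * Real.sqrt ((gammaPs d a')⁻¹) / N + C := by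
  set J := JK0 N R M with hJ
  set G' := Gps (R * N) M a' with hG'
  set G := Gps N M a' with hG
  have e : G' * J - J * G = (1 - J * Jᴴ) * G' * J + J * (Jᴴ * G' * J - G) := by
    simp only [Matrix.sub_mul, Matrix.mul_sub, Matrix.one_mul, Matrix.mul_assoc]; abel
  have hJ1 : ‖J‖ ≤ 1 := opNorm_JK0_le N R M
  have h1 : ‖(1 - J * Jᴴ) * G'‖ ≤ 2 * d * Real.sqrt ((gammaPs d a')⁻¹) / N := by
    have eflip : (1 - J * Jᴴ) * G' = (G' * (1 - J * Jᴴ))ᴴ := by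
      rw [Matrix.conjTranspose_mul, (Gps_isHermitian (R * N) M a').eq, Matrix.conjTranspose_sub, Matrix.conjTranspose_one,
        Matrix.conjTranspose_mul, Matrix.conjTranspose_conjTranspose]
    rw [eflip, Matrix.l2_opNorm_conjTranspose]
    exact opNorm_Gps_mul_one_sub_Pi0_le N R M hd ha'
  have h2 : ‖Jᴴ * G' * J - G‖ ≤ C := by
    rw [← norm_neg, neg_sub]; exact opNorm_Gps_sub_sandwich_le N R M a' ha' hC hX
  rw [e]
  calc ‖(1 - J * Jᴴ) * G' * J + J * (Jᴴ * G' * J - G)‖ ≤ ‖(1 - J * Jᴴ) * G' * J‖ + ‖J * (Jᴴ * G' * J - G)‖ := norm_add_le _ _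
    _ ≤ ‖(1 - J * Jᴴ) * G'‖ * ‖J‖ + ‖J‖ * ‖Jᴴ * G' * J - G‖ := add_le_add (Matrix.l2_opNorm_mul _ _) (Matrix.l2_opNorm_mul _ _)
    _ ≤ 2 * d * Real.sqrt ((gammaPs d a')⁻¹) / N * 1 + 1 * C :=
        add_le_add (mul_le_mul h1 hJ1 (norm_nonneg _) (by positivity)) (mul_le_mul hJ1 h2 (norm_nonneg _) zero_le_one)
    _ = _ := by ring

end TwoLevel

/-! ## §4 Along the tower: the free scalar-tower laws from the excess bound -/

section TowerLevel

variable (L : ℕ) [NeZero L] (M : Fin d → ℕ) [hM : ∀ μ, NeZero (M μ)] (a' : ℝ)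

/-- the one-step effective Laplacian along the tower (level `k ← k+1`). [folklore] -/
abbrev effLapLev (k : ℕ) : Matrix (Tor (fine (lev L k) M)) (Tor (fine (lev L k) M)) ℂ := effLap (lev L k) L M

/-- **THE U = 1 SCALAR FREE-TOWER LAWS FROM THE EFFECTIVE-LAPLACIAN EXCESS** (`d ≥ 1`, `a′ > 0`): if at every level
`Re⟨G′_kv, (Δ̃_k − Δ_k)G′_kv⟩ ≤ C_X·L^{−k}·Σ|v|²`, then the scalar tower `(DeltaPs (L^k) M a′)_k` with King's 0-form averagings / plantings
satisfies `FreeTowerLaws` with pairing defect `0`, complement defect `2d√(γ′⁻¹)·L^{−k}` and injected defect `(2d√(γ′⁻¹) + C_X)·L^{−k}`.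
[folklore] -/
theorem freeTowerLaws_scalar_of_excess (hd : 0 < d) (ha' : 0 < a') {CX : ℝ} (hCX : 0 ≤ CX)
    (hX : ∀ (k : ℕ) (v : Tor (fine (lev L k) M) → ℂ),
      (star (Gps (lev L k) M a' *ᵥ v) ⬝ᵥ ((effLapLev L M k - LapS (fine (lev L k) M) ((lev L k : ℕ) : ℂ)) *ᵥ (Gps (lev L k) M a' *ᵥ v))).re
        ≤ CX * ((L : ℝ)⁻¹) ^ k * nsq v) :
    FreeTowerLaws (fun k => DeltaPs (lev L k) M a') (Q0lev L M) (J0pcT L M) (fun _ => 0) ((L : ℝ) ^ d)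
      (fun k => 2 * d * Real.sqrt ((gammaPs d a')⁻¹) * ((L : ℝ)⁻¹) ^ k)
      (fun k => (2 * d * Real.sqrt ((gammaPs d a')⁻¹) + CX) * ((L : ℝ)⁻¹) ^ k) (fun _ => 0) where
  isUnit_det k := isUnit_det_DeltaPs (lev L k) M ha'
  opNorm_A_sq_le k := opNorm_Q0lev_sq_le L M k
  opNorm_J_le k := opNorm_J0pcT_le L M k
  A_mul_J k := sqrt_smul_Q0lev_mul_J0pcT L M k
  opNorm_F_mul_inv_le k := by rw [Matrix.zero_mul, norm_zero]
  opNorm_inv_mul_F_le k := by rw [Matrix.conjTranspose_zero, Matrix.mul_zero, norm_zero]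
  complement_le k := complement_le_lev0 L M hd ha' k
  injected_le k := by
    have hLk : (0 : ℝ) ≤ ((L : ℝ)⁻¹) ^ k := pow_nonneg (inv_nonneg.mpr (Nat.cast_nonneg L)) k
    have h := opNorm_injected_le (lev L k) L M a' hd ha' (C := CX * ((L : ℝ)⁻¹) ^ k) (by positivity) (hX k)
    rw [cast_lev'] at h
    have e : 2 * (d : ℝ) * Real.sqrt ((gammaPs d a')⁻¹) / (L : ℝ) ^ k + CX * ((L : ℝ)⁻¹) ^ k
        = (2 * d * Real.sqrt ((gammaPs d a')⁻¹) + CX) * ((L : ℝ)⁻¹) ^ k := by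
      rw [inv_pow, div_eq_mul_inv]; ring
    rw [e] at h
    exact h

end TowerLevel

end Summit.QuantumFields.BalabanUV.T4Continuum.ScalarSandwichReduction

end
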